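import Summits.ResolutionOfSingularities.ResolutionOfSingularities.Theorems.PurelyInseparableDim4ScopeBlindRational
import Summits.ResolutionOfSingularities.ResolutionOfSingularities.Theorems.PurelyInseparableDim4WinCertAllFieldsScope
import HarnessLib

/-!
# RATIONAL-CURVE blindness certificates go UP along the coefficient map
# (cell `res-dim4-pi`; the `.rat` leaf of the ∀K column — the transfer `…WinCertAllFieldsScope` leaves out)

[OURS · counted 0 · instrument] Nothing here is a statement about resolution of singularities.
res-dim4-p-13's `ScopeBlind.rblindB q s P v D k α₀ a` (`…ScopeBlindRational`) certifies by `decide` that a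
presented state `s` over a field `k` is OUT of coordinate scope: a rational curve `xᵢ = Pᵢ(t)·D(t)^{-vᵢ}`
through the origin lies in `V(J_q⁺(F))`, and a Hasse derivative is non-zero at a point of the curve's coordinate
hull.  res-dim4-p-14 g2's `WinCertAllFields.not_inCoordinateScope_map_of_blindB` moves MONOMIAL-curve
certificates to every field `K ⊇ k`; its docstring records «NOT here: `.rat` leaves (a power-series transfer)».
This file is that transfer:

* §1 the coefficient map on term lists `L.map (·.1, f ·.2)` (inline, def-free): `map_evalT`, `coeffAt_map`, `maxV_map`; the naturality of
  the kit's power-series pieces: `psi_map`, `ps_map_terms`, `map_inv_ps` (the inverse of `D` in `K⟦t⟧` is the image of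
  the inverse in `k⟦t⟧`), **`rcurveHom_map`**: `φ_{P⊗K} ∘ (⊗K) = (⊗K) ∘ φ_P` on `k[x₁..x₄]`;
* §2 **`not_inCoordinateScope_map_of_rblindB`**: `rblindB q s P v D k α₀ a = true` over `k` ⇒
  `¬ InCoordinateScope q ((evalT s.L) ⊗ K)` for every ring map `f : k →+* K` of fields — the semantic facts
  certified over `k` (curve kills `J_q⁺`, passes through `0`, coordinates off `V` non-zero, witness derivative
  non-zero) are pushed to `K` along `f` and fed to res-dim4-p-3's `IsolationCert.not_inCoordinateScope_of_ringHom`.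
* §3 acceptance: the `p = 2` census shape `x₃x₄² + x₃³ + x₃³x₄²` of `…ScopeBlindRational` is blind over EVERY field
  of characteristic `2` (`not_inCoordinateScope_r4bGraph_allFields`).
First consumer: res-dim4-p-8 g3's `𝔽₉` lane (LOOP-E's `√−1` replies are blind over every field containing `√−1`).
OURS; counted 0.  bears_on: LADDER-RESOLUTION:D157-DOOR2 (res-dim4-pi · frame v4 scope column · ∀K gap).
Supports stmt-ResolutionOfSingularities-16155 (helper).
-/

set_option linter.dupNamespace false -- mandated namespace of this single-conjunct summit

noncomputable section

open MvPolynomial Finset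

namespace Summit.ResolutionOfSingularities.ResolutionOfSingularities.Theorems.PIDim4

namespace StepKit

variable {n : ℕ} {R S : Type*} [CommRing R] [CommRing S]

/-- **The coefficient map on a presented polynomial is the presented polynomial of the mapped list**
`L.map (·.1, f ·.2)` (written inline throughout; no new definition). [folklore] -/
theorem map_evalT (f : R →+* S) (L : Terms n R) :
    MvPolynomial.map f (evalT L) = evalT (L.map fun t => (t.1, f t.2)) := by
  induction L with
  | nil => simp
  | cons t L ih => rw [List.map_cons, evalT_cons, evalT_cons, map_add, MvPolynomial.map_monomial, ih]

/-- `coeffAt` is natural. [folklore] -/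
theorem coeffAt_map (f : R →+* S) (L : Terms n R) (e : Fin n → ℕ) :
    coeffAt (L.map fun t => (t.1, f t.2)) e = f (coeffAt L e) := by
  induction L with
  | nil => simp [coeffAt]
  | cons t L ih =>
    simp only [List.map_cons, coeffAt] at ih ⊢
    split_ifs <;> simp [ih]

end StepKit

namespace ScopeBlind

open StepKit ScopeCover
open Literature.AlgebraicGeometry.Resolution

variable {k K : Type} [Field k] [Field K] (f : k →+* K)

/-! ## §1 Naturality of the power-series pieces -/

omit [Field K] in
/-- the common denominator exponent only reads exponents. [folklore] -/
theorem maxV_map {S : Type} [CommRing S] (g : k →+* S) (v : Fin 4 → ℕ) (L : Terms 4 k) :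
    maxV v (L.map fun t => (t.1, g t.2)) = maxV v L := by
  unfold maxV
  rw [List.map_map]
  rfl

/-- `psi` (`k[t] → k⟦t⟧`) commutes with the coefficient map. [folklore] -/
theorem psi_map (G : MvPolynomial (Fin 1) k) :
    psi (MvPolynomial.map f G) = PowerSeries.map f (psi G) := by
  have h : (psi (K := K)).toRingHom.comp (MvPolynomial.map f) =
      (PowerSeries.map f).comp (psi (K := k)).toRingHom := by
    refine MvPolynomial.ringHom_ext (fun r => ?_) (fun j => ?_)
    · simp only [RingHom.comp_apply, AlgHom.toRingHom_eq_coe, AlgHom.coe_toRingHom, map_C]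
      rw [psi, psi, MvPolynomial.algHom_C, MvPolynomial.algHom_C, PowerSeries.C_eq_algebraMap.symm,
        PowerSeries.C_eq_algebraMap.symm, PowerSeries.map_C]
    · simp only [RingHom.comp_apply, AlgHom.toRingHom_eq_coe, AlgHom.coe_toRingHom, map_X]
      rw [psi, psi, MvPolynomial.aeval_X, MvPolynomial.aeval_X, PowerSeries.map_X]
  exact congrArg (fun φ : MvPolynomial (Fin 1) k →+* PowerSeries K => φ G) h

/-- the power series of a mapped term list is the mapped power series. [folklore] -/
theorem ps_map_terms (L : Terms 1 k) : ps (L.map fun t => (t.1, f t.2)) = PowerSeries.map f (ps L) := by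
  rw [ps, ps, ← map_evalT, psi_map]

/-- constant coefficients along the coefficient map. [folklore] -/
theorem constantCoeff_map_ps (L : Terms 1 k) :
    PowerSeries.constantCoeff (ps (L.map fun t => (t.1, f t.2))) = f (PowerSeries.constantCoeff (ps L)) := by
  rw [ps_map_terms, ← PowerSeries.coeff_zero_eq_constantCoeff_apply, PowerSeries.coeff_map,
    PowerSeries.coeff_zero_eq_constantCoeff_apply]

/-- **the inverse of `D` in `K⟦t⟧` is the image of its inverse in `k⟦t⟧`** (`D(0) ≠ 0`). [folklore] -/
theorem map_inv_ps (D : Terms 1 k) (hD : PowerSeries.constantCoeff (ps D) ≠ 0) :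
    PowerSeries.map f ((ps D)⁻¹) = (ps (D.map fun t => (t.1, f t.2)))⁻¹ := by
  have hDf : PowerSeries.constantCoeff (ps (D.map fun t => (t.1, f t.2))) ≠ 0 := by
    rw [constantCoeff_map_ps]; exact (map_ne_zero_iff f f.injective).mpr hD
  rw [PowerSeries.eq_inv_iff_mul_eq_one hDf, ps_map_terms, ← map_mul, PowerSeries.inv_mul_cancel _ hD, map_one]

/-- **The rational curve commutes with the coefficient map**: `φ_{P ⊗ K}(G ⊗ K) = (φ_P G) ⊗ K`. [folklore] -/
theorem rcurveHom_map (P : Fin 4 → Terms 1 k) (v : Fin 4 → ℕ) (D : Terms 1 k)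
    (hD : PowerSeries.constantCoeff (ps D) ≠ 0) (G : MvPolynomial (Fin 4) k) :
    rcurveHom (fun i => (P i).map fun t => (t.1, f t.2)) v (D.map fun t => (t.1, f t.2)) (MvPolynomial.map f G) =
      PowerSeries.map f (rcurveHom P v D G) := by
  have h : (rcurveHom (fun i => (P i).map fun t => (t.1, f t.2)) v (D.map fun t => (t.1, f t.2))).toRingHom.comp (MvPolynomial.map f) =
      (PowerSeries.map f).comp (rcurveHom P v D).toRingHom := by
    refine MvPolynomial.ringHom_ext (fun r => ?_) (fun j => ?_)
    · simp only [RingHom.comp_apply, AlgHom.toRingHom_eq_coe, AlgHom.coe_toRingHom, map_C]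
      rw [rcurveHom, rcurveHom, MvPolynomial.algHom_C, MvPolynomial.algHom_C, PowerSeries.C_eq_algebraMap.symm,
        PowerSeries.C_eq_algebraMap.symm, PowerSeries.map_C]
    · simp only [RingHom.comp_apply, AlgHom.toRingHom_eq_coe, AlgHom.coe_toRingHom, map_X]
      rw [rcurveHom, rcurveHom, MvPolynomial.aeval_X, MvPolynomial.aeval_X, map_mul, map_pow, ps_map_terms,
        map_inv_ps f D hD]
  exact congrArg (fun φ : MvPolynomial (Fin 4) k →+* PowerSeries K => φ G) h

/-! ## §2 The transfer -/

/-- **A rational-curve blindness certificate over `k` certifies blindness over every `K ⊇ k`** (the `.rat` twin of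
`WinCertAllFields.not_inCoordinateScope_map_of_blindB`). [folklore] -/
theorem not_inCoordinateScope_map_of_rblindB [DecidableEq k] {q : ℕ} {s : SData 4 k} {P : Fin 4 → Terms 1 k}
    {v : Fin 4 → ℕ} {D : Terms 1 k} {kk α₀ : Fin 4 → ℕ} {a : Fin 4 → k} (h : rblindB q s P v D kk α₀ a = true) :
    ¬ InCoordinateScope q (MvPolynomial.map f (evalT s.L)) := by
  simp only [rblindB, Bool.and_eq_true, decide_eq_true_eq, List.all_eq_true, Bool.not_eq_true',
    decide_eq_false_iff_not] at h
  obtain ⟨⟨⟨⟨⟨hP, hD⟩, hJ⟩, ha⟩, hα₀⟩, hne⟩ := h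
  have hD' : PowerSeries.constantCoeff (ps D) ≠ 0 := by
    rwa [← PowerSeries.coeff_zero_eq_constantCoeff_apply, ps, coeff_psi_evalT]
  have hdeg : (expo α₀).degree = ∑ i, α₀ i := degree_expo α₀
  -- the mapped curve data
  have hPf : ∀ i, coeffAt ((P i).map fun t => (t.1, f t.2)) (fun _ => 0) = 0 := fun i => by
    rw [coeffAt_map, hP i, map_zero]
  have hnat := rcurveHom_map f P v D hD'
  refine IsolationCert.not_inCoordinateScope_of_ringHom
    (rcurveHom (fun i => (P i).map fun t => (t.1, f t.2)) v (D.map fun t => (t.1, f t.2))).toRingHom (fun α h0 hq => ?_)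
    (fun g hg => ?_) (Finset.univ.filter fun i => coeffAt (P i) (fun _ => kk i) = 0) (fun i hi => ?_)
    (expo α₀) (by rw [hdeg]; exact hα₀.1) (by rw [hdeg]; exact hα₀.2) (f ∘ a) (fun i hi => ?_) ?_
  · -- every Hasse derivative of the mapped polynomial dies on the mapped curve
    change rcurveHom (fun i => (P i).map fun t => (t.1, f t.2)) v (D.map fun t => (t.1, f t.2))
      (hasseDeriv α (MvPolynomial.map f (evalT s.L))) = 0
    have hk : rcurveHom P v D (hasseDeriv α (evalT s.L)) = 0 := by
      rw [← expo_coe α, hasseDeriv_evalT]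
      apply rcurveHom_evalT_eq_zero P v D hD'
      rw [evalT_eq_zero_iff]
      exact hJ (⇑α) (mem_idxLT h0 hq)
    rw [IsolationConverse.hasseDeriv_map, hnat, hk, map_zero]
  · -- the kernel lies in `𝔪₀`: the mapped curve passes through the origin
    rw [← IsolationCert.constantCoeff_aeval_curve _ (rcurve_constantCoeff _ v _ hPf) g]
    change PowerSeries.constantCoeff (rcurveHom (fun i => (P i).map fun t => (t.1, f t.2)) v (D.map fun t => (t.1, f t.2)) g) = 0
    rw [show rcurveHom (fun i => (P i).map fun t => (t.1, f t.2)) v (D.map fun t => (t.1, f t.2)) g = 0 from hg, map_zero]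
  · -- coordinates off `V` are non-zero on the curve
    change rcurveHom (fun i => (P i).map fun t => (t.1, f t.2)) v (D.map fun t => (t.1, f t.2)) (X i) ≠ 0
    have hki : coeffAt (P i) (fun _ => kk i) ≠ 0 := by simpa using hi
    have hPi : ps (P i) ≠ 0 := by
      intro h0; apply hki; rw [← coeff_psi_evalT, ← ps, h0, map_zero]
    have hinv : ((ps D)⁻¹ : PowerSeries k) ≠ 0 := by
      intro h0
      have := PowerSeries.mul_inv_cancel (ps D) hD'
      rw [h0, mul_zero] at this
      exact zero_ne_one this
    have hk : rcurveHom P v D (X i) ≠ 0 := by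
      rw [rcurveHom, MvPolynomial.aeval_X]
      exact mul_ne_zero hPi (pow_ne_zero _ hinv)
    rw [← MvPolynomial.map_X f i, hnat]
    intro h0
    exact hk (PowerSeries.map_injective f f.injective (by rw [h0, map_zero]))
  · -- the witness point vanishes on `V`
    rw [Function.comp_apply, ha i (by simpa using hi), map_zero]
  · -- the witness derivative does not vanish at the mapped point
    rw [IsolationConverse.hasseDeriv_map, WinCertAllFields.eval_comp_map, hasseDeriv_evalT, eval_evalT]
    exact (map_ne_zero_iff f f.injective).mpr hne

/-- the same, for any presentation `F = (evalT s.L) ⊗ K` of the mapped polynomial as a state over `K` whose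
polynomial is literally the base change. [folklore] -/
theorem not_inCoordinateScope_of_rblindB_of_eq_map [DecidableEq k] {q : ℕ} {s : SData 4 k} {P : Fin 4 → Terms 1 k}
    {v : Fin 4 → ℕ} {D : Terms 1 k} {kk α₀ : Fin 4 → ℕ} {a : Fin 4 → k} (h : rblindB q s P v D kk α₀ a = true)
    {F : MvPolynomial (Fin 4) K} (hF : F = MvPolynomial.map f s.toState.F) : ¬ InCoordinateScope q F := by
  rw [hF, SData.toState_F]
  exact not_inCoordinateScope_map_of_rblindB f h

/-! ## §3 Acceptance: the `p = 2` graph-type census shape is blind over every field of characteristic 2 -/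

/-- **`x₃x₄² + x₃³ + x₃³x₄²` (`V(J₂⁺) = {x₄(1+x₃) = x₃}`, `…ScopeBlindRational.r4bGraph`) is OUT of coordinate scope
over EVERY field of characteristic `2`**, by the `𝔽₂` rational-curve certificate `rblindB_r4bGraph` pushed along the
structure map. [OURS · ‖ K] -/
theorem not_inCoordinateScope_r4bGraph_allFields (K : Type) [Field K] [CharP K 2] :
    ¬ InCoordinateScope 2 (MvPolynomial.map (ZMod.castHom (dvd_refl 2) K) r4bGraph.toState.F) :=
  not_inCoordinateScope_of_rblindB_of_eq_map (ZMod.castHom (dvd_refl 2) K) rblindB_r4bGraph rfl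

end ScopeBlind

end Summit.ResolutionOfSingularities.ResolutionOfSingularities.Theorems.PIDim4

end
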